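import Mathlib
import Literature.Probability.Percolation.Crossings
import Literature.Probability.Percolation.SiteConnectionTools
import Literature.Probability.Percolation.BondPercolationSymmetry
import Literature.Probability.Percolation.LatticeSymmetry
import Literature.Probability.Percolation.InequalitiesProofs
import Literature.Probability.Percolation.MinOpenCut
import Literature.Probability.Percolation.SupercriticalClusterTransienceCorners
import Summits.CriticalPhenomena.PercolationContinuityZ3.Theorems.PinholeClosing.Negative.PinholeClosingBaseline
import HarnessLib

/-!
# Crux `PercBudgetLadder.PinholeClosing` (stmt-CriticalPhenomena-5249), line `halfspace-polarisation` — stub `stub_signedSymmetry`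

Helper file for the crux skeleton `Cruxes/PinholeClosing/Lines/halfspace_polarisation.lean`
(lead prover-line-stmt-CriticalPhenomena-5249-0); proves exactly the registered stub `stub_signedSymmetry`
(`--supports stmt-CriticalPhenomena-5249`).  No new definitions: statements are in the tree's vocabulary
(`bondPercolation (zdGraph 3) (criticalProbI 3)`, `box`, `innerBoundary`, `openConnIn`).

Informal statement: for critical bond percolation `P = P_{p_c}` on `ℤ³`, the probability of
the "front-blocked half-box" event — no open path from the translated box `z + Λ(n)` to the
translated inner boundary `z + ∂ⁱⁿΛ(L)` using only vertices of the closed front half-box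
`F(i, σ, z, L) = {v | v - z ∈ Λ(L), 0 ≤ σ (v i - z i)}` — does not depend on the signed
axis `(i, σ)`, `σ = ±1`, nor on the centre `z`: it equals the probability of the canonical
event (axis `0`, sign `+1`, centre `0`).

Proof: both events are complements of open crossing events `C(S; A, B)` (`openCrossing`,
`Crossings.lean`); complements of open crossing events are transported along graph isomorphisms
exactly like the crossing events themselves (`bondPercolation_real_preimage_relabel_iso`,
`preimage_relabel_openCrossing`, the `step` inside the final proof). The
isomorphism is the signed coordinate permutation `zdSignedPermIso (swap 0 i) (fun _ => σ)`
followed by the translation `zdShiftIso z` (`SiteConnectionTools.lean`); it maps `Λ(n)` onto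
`z + Λ(n)` (`signedPerm_image_box`), `∂ⁱⁿΛ(L)` onto `z + ∂ⁱⁿΛ(L)` (a graph automorphism
preserving `Λ(L)` preserves its inner boundary,
`StubSignedSymmetry.iso_mem_innerBoundary_iff`) and the canonical half-box
`{v ∈ Λ(L) | 0 ≤ v 0}` onto `F(i, σ, z, L)` (`StubSignedSymmetry.image_frontHalfBox`, using
`σ² = 1`).
-/

noncomputable section

namespace Summit.CriticalPhenomena.PercolationContinuityZ3.Theorems

open MeasureTheory Filter
open Literature.Probability.Percolation Literature.Probability.LatticeModels
open Summit.CriticalPhenomena.PercolationContinuityZ3.Theorems.PinholeClosing.Negative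

namespace StubSignedSymmetry

/-- A graph automorphism `ψ` preserving a finite vertex set `Λ` preserves its inner boundary:
`ψ x ∈ ∂ⁱⁿΛ ↔ x ∈ ∂ⁱⁿΛ`. -/
theorem iso_mem_innerBoundary_iff {V : Type*} [DecidableEq V] {G : SimpleGraph V}
    [G.LocallyFinite] (ψ : G ≃g G) {Λ : Finset V} (h : ∀ x, ψ x ∈ Λ ↔ x ∈ Λ)
    (x : V) : ψ x ∈ innerBoundary G Λ ↔ x ∈ innerBoundary G Λ := by
  simp only [mem_innerBoundary_iff]
  constructor
  · rintro ⟨hx, w, hw, hadj⟩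
    refine ⟨(h x).1 hx, ψ.symm w, fun hw' => hw ?_, ?_⟩
    · have := (h (ψ.symm w)).2 hw'
      rwa [RelIso.apply_symm_apply] at this
    · have := ψ.symm.map_adj_iff.2 hadj
      rwa [RelIso.symm_apply_apply] at this
  · rintro ⟨hx, w, hw, hadj⟩
    exact ⟨(h x).2 hx, ψ w, fun hw' => hw ((h w).1 hw'), ψ.map_adj_iff.2 hadj⟩

/-- Signed coordinate permutations map the inner boundary `∂ⁱⁿΛ(L)` of a box of `ℤ^d` onto
itself (they preserve `Λ(L)`, `signedPerm_mem_box_iff`). -/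
theorem signedPerm_image_innerBoundary_box {d : ℕ} (π : Equiv.Perm (Fin d))
    (ε : Fin d → ℤˣ) (L : ℕ) :
    (Site.signedPerm π ε) '' (↑(innerBoundary (zdGraph d) (box d L)) : Set (Site d)) =
      ↑(innerBoundary (zdGraph d) (box d L)) := by
  have h : ∀ x, (zdSignedPermIso π ε) x ∈ innerBoundary (zdGraph d) (box d L) ↔
      x ∈ innerBoundary (zdGraph d) (box d L) :=
    iso_mem_innerBoundary_iff (zdSignedPermIso π ε) (fun _ => signedPerm_mem_box_iff π ε)
  ext y
  constructor
  · rintro ⟨x, hx, rfl⟩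
    exact (h x).2 hx
  · intro hy
    refine ⟨(Site.signedPerm π ε).symm y, ?_, Equiv.apply_symm_apply _ _⟩
    have := h ((Site.signedPerm π ε).symm y)
    rw [zdSignedPermIso_apply, Equiv.apply_symm_apply] at this
    exact this.1 hy

/-- Translates of finite vertex sets of `ℤ^d`: `(x ↦ x + v) '' s = s + v` (as the coercion of
`s.image (· + v)`). -/
theorem zdShiftIso_image_coe {d : ℕ} (v : Site d) (s : Finset (Site d)) :
    (zdShiftIso v) '' (↑s : Set (Site d)) = ↑(s.image (· + v)) := by
  rw [Finset.coe_image]; rfl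

/-- The canonical front half-box `{v ∈ Λ(L) | 0 ≤ v 0}` is carried onto the front half-box
`{v | v - z ∈ Λ(L), 0 ≤ s (v i - z i)}` of the signed axis `(i, s)` centred at `z` by the
signed permutation `swap 0 i` with all signs equal to `s`, followed by the translation by `z`
(coordinate `i` of the image of `u` is `s · u 0 + z i`, and `s² = 1`). -/
theorem image_frontHalfBox (i : Fin 3) (s : ℤˣ) (z : Site 3) (L : ℕ) :
    (zdShiftIso z) '' ((zdSignedPermIso (Equiv.swap 0 i) (fun _ => s)) ''
        {v : Site 3 | v ∈ box 3 L ∧ 0 ≤ v 0}) =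
      {v : Site 3 | v - z ∈ box 3 L ∧ 0 ≤ (s : ℤ) * (v i - z i)} := by
  ext v
  simp only [Set.mem_image, Set.mem_setOf_eq, zdShiftIso_apply, zdSignedPermIso_apply]
  constructor
  · rintro ⟨w, ⟨u, ⟨hu, hu0⟩, rfl⟩, rfl⟩
    refine ⟨?_, ?_⟩
    · rw [add_sub_cancel_right]
      exact (signedPerm_mem_box_iff _ _).2 hu
    · have : (Site.signedPerm (Equiv.swap 0 i) (fun _ => s) u + z) i - z i = (s : ℤ) * u 0 := by
        simp [Equiv.symm_swap, Equiv.swap_apply_right]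
      rw [this, ← mul_assoc, Int.units_coe_mul_self, one_mul]
      exact hu0
  · rintro ⟨hv, hv0⟩
    refine ⟨v - z, ⟨(Site.signedPerm (Equiv.swap 0 i) (fun _ => s)).symm (v - z), ⟨?_, ?_⟩,
      Equiv.apply_symm_apply _ _⟩, sub_add_cancel v z⟩
    · rw [← signedPerm_mem_box_iff (Equiv.swap 0 i) (fun _ => s), Equiv.apply_symm_apply]
      exact hv
    · rw [Site.signedPerm_symm_apply, Equiv.swap_apply_left, Pi.sub_apply]
      exact hv0

end StubSignedSymmetry

open StubSignedSymmetry in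
/-- **Lattice symmetry of the front-blocked half-box event.** For critical bond percolation
on `ℤ³`, the probability that there is no open path from `z + Λ(n)` to `z + ∂ⁱⁿΛ(L)` inside
the front half-box `{v | v - z ∈ Λ(L), 0 ≤ σ (v i - z i)}` of the signed axis `(i, σ)`,
`σ = ±1`, centred at `z`, equals the probability of the canonical event (axis `0`, `σ = 1`,
`z = 0`).
Proof: both events are complements of open crossing events, and the automorphism
`x ↦ signedPerm (swap 0 i) (fun _ => σ) x + z` of `ℤ³` carries the canonical data (half-box,
sources `Λ(n)`, targets `∂ⁱⁿΛ(L)`) onto the translated/rotated data; `P_{p_c}` is invariant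
(`bondPercolation_real_preimage_relabel_iso`). -/
theorem stub_signedSymmetry :
    ∀ (i : Fin 3) (σ : ℤ) (z : Site 3) (n L : ℕ), (σ = 1 ∨ σ = -1) →
      (bondPercolation (zdGraph 3) (criticalProbI 3)).real
        {ω : BondConfig (Site 3) | ¬ ∃ x ∈ (box 3 n).image (· + z), ∃ y ∈ (innerBoundary (zdGraph 3) (box 3 L)).image (· + z), ω ∈ openConnIn {v : Site 3 | v - z ∈ box 3 L ∧ 0 ≤ σ * (v i - z i)} x y} =
      (bondPercolation (zdGraph 3) (criticalProbI 3)).real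
        {ω : BondConfig (Site 3) | ¬ ∃ x ∈ box 3 n, ∃ y ∈ innerBoundary (zdGraph 3) (box 3 L), ω ∈ openConnIn {v : Site 3 | v ∈ box 3 L ∧ 0 ≤ v 0} x y} := by
  intro i σ z n L hσ
  -- `σ = ±1` is a unit `s : ℤˣ`
  obtain ⟨s, rfl⟩ : ∃ s : ℤˣ, (s : ℤ) = σ := by
    rcases hσ with rfl | rfl
    exacts [⟨1, rfl⟩, ⟨-1, rfl⟩]
  -- both events are complements of open crossing events
  have hL : {ω : BondConfig (Site 3) | ¬ ∃ x ∈ (box 3 n).image (· + z),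
      ∃ y ∈ (innerBoundary (zdGraph 3) (box 3 L)).image (· + z),
        ω ∈ openConnIn {v : Site 3 | v - z ∈ box 3 L ∧ 0 ≤ (s : ℤ) * (v i - z i)} x y} =
      (openCrossing {v : Site 3 | v - z ∈ box 3 L ∧ 0 ≤ (s : ℤ) * (v i - z i)}
        ↑((box 3 n).image (· + z))
        ↑((innerBoundary (zdGraph 3) (box 3 L)).image (· + z)))ᶜ := by
    ext ω
    simp only [Set.mem_setOf_eq, Set.mem_compl_iff, mem_openCrossing_iff, Finset.mem_coe]
  have hR : {ω : BondConfig (Site 3) | ¬ ∃ x ∈ box 3 n,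
      ∃ y ∈ innerBoundary (zdGraph 3) (box 3 L),
        ω ∈ openConnIn {v : Site 3 | v ∈ box 3 L ∧ 0 ≤ v 0} x y} =
      (openCrossing {v : Site 3 | v ∈ box 3 L ∧ 0 ≤ v 0} ↑(box 3 n)
        ↑(innerBoundary (zdGraph 3) (box 3 L)))ᶜ := by
    ext ω
    simp only [Set.mem_setOf_eq, Set.mem_compl_iff, mem_openCrossing_iff, Finset.mem_coe]
  rw [hL, hR, ← image_frontHalfBox i s z L]
  -- the sources/targets are the images of `Λ(n)`/`∂ⁱⁿΛ(L)` under the same automorphism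
  have hA : (↑((box 3 n).image (· + z)) : Set (Site 3)) =
      (zdShiftIso z) '' ((zdSignedPermIso (Equiv.swap 0 i) (fun _ => s)) '' ↑(box 3 n)) := by
    rw [show ((zdSignedPermIso (Equiv.swap 0 i) (fun _ => s) : zdGraph 3 ≃g zdGraph 3) :
        Site 3 → Site 3) = Site.signedPerm (Equiv.swap 0 i) (fun _ => s) from rfl,
      signedPerm_image_box, zdShiftIso_image_coe]
  have hB : (↑((innerBoundary (zdGraph 3) (box 3 L)).image (· + z)) : Set (Site 3)) =
      (zdShiftIso z) '' ((zdSignedPermIso (Equiv.swap 0 i) (fun _ => s)) ''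
        ↑(innerBoundary (zdGraph 3) (box 3 L))) := by
    rw [show ((zdSignedPermIso (Equiv.swap 0 i) (fun _ => s) : zdGraph 3 ≃g zdGraph 3) :
        Site 3 → Site 3) = Site.signedPerm (Equiv.swap 0 i) (fun _ => s) from rfl,
      signedPerm_image_innerBoundary_box, zdShiftIso_image_coe]
  -- transport along `zdShiftIso z`, then along the signed permutation: complements of open
  -- crossing events are transported like the events themselves (`preimage_relabel_openCrossing`)
  have step : ∀ (φ : zdGraph 3 ≃g zdGraph 3) (S A B : Set (Site 3)),
      (bondPercolation (zdGraph 3) (criticalProbI 3)).real (openCrossing (φ '' S) (φ '' A) (φ '' B))ᶜ =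
        (bondPercolation (zdGraph 3) (criticalProbI 3)).real (openCrossing S A B)ᶜ := by
    intro φ S A B
    rw [← bondPercolation_real_preimage_relabel_iso φ (criticalProbI 3), Set.preimage_compl]
    exact congrArg (fun T => (bondPercolation (zdGraph 3) (criticalProbI 3)).real Tᶜ)
      (preimage_relabel_openCrossing φ.toEquiv S A B)
  rw [hA, hB, step, step]

end Summit.CriticalPhenomena.PercolationContinuityZ3.Theorems

end
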